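import Summits.BirchSwinnertonDyer.BirchSwinnertonDyer.Theorems.ClassRecordThreeRegCertKernelO2Log
import Literature.NumberTheory.EllipticCurves.TateJSecondOrderProofs
import HarnessLib

/-!
# Route `ClassRecordThree`, crux `SchneiderAtThree` (item 19106): THIRD-ORDER ingredients of the REG3CERT kernel evaluator —
# `s₃(q) ≡ q (mod 27)`, THE Tate parameter to second order `q ≡ q₀ + 744q₀²`, and `C²` modulo `81`
# (cell `bsd-stepL`, seat `bsd-stepL-reg3-eng` g3; `--supports stmt-BirchSwinnertonDyer-19106`)

HONEST FRAMING: BSD is not proved by any of this; `3`-adic estimates, no statement about any curve's height. For REG3CERT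
rows with `v₃(h(Q)) = 3` the scale `C²` is needed modulo `81`: `C² = −c₄(1 − 504s₅)/(c₆(1 + 240s₃))` with
`s₅ ≡ q ≡ q₀ = Δ/c₄³ (mod 9)` and `s₃ ≡ q ≡ q₀ + 744q₀² (mod 27)` (the tree's SECOND-order `1/j`-expansion
`norm_inv_tateJ_sub_add_le`), whence `C² ≡ −c₄J(J − 504Δ)/(c₆(J² + 240ΔJ + 178560Δ²)) (mod 81)`, `J = c₄³`
(`norm_uniformisationScaleSq_sub_le_o3`). Theorems only (0 defs, 0 facts).
References: [SilvermanATAEC1994] V.1, V.3, V.5; [SteinWuthrich2013] §4.2.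
-/

open scoped Classical
open scoped ArithmeticFunction.sigma

open WeierstrassCurve Literature.NumberTheory.EllipticCurves
  Literature.NumberTheory.EllipticCurves.SteinWuthrich2013

namespace Summit.BirchSwinnertonDyer.Rank1Residual.X11b.RegMult.KernelCert

/-! ### §1 `s₃(q) ≡ q (mod 27)` -/

/-- **`‖s₃(q) − q‖₃ ≤ 3⁻³` for `‖q‖₃ ≤ 3⁻¹`** (`s₃(q) = q + 9q² + 28q³ + ⋯`: `‖9q²‖ ≤ 3⁻⁴`, later terms `≤ ‖q‖³`).
[cite: SilvermanATAEC1994, Ch. V §1 (1.1)(b)] -/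
theorem norm_tateS_three_sub_self_le {q : ℚ_[3]} (hq : ‖q‖ ≤ 1 / 3) : ‖tateS 3 q - q‖ ≤ 1 / 27 := by
  have hq1 : ‖q‖ < 1 := hq.trans_lt (by norm_num)
  have hsum := TateCurve.summable_tateS_term 3 hq1
  have hsplit := hsum.sum_add_tsum_nat_add 1
  have hone : ∑ i ∈ Finset.range 1, ((σ 3 (i + 1) : ℕ) : ℚ_[3]) * q ^ (i + 1) = q := by
    simp [ArithmeticFunction.sigma_one]
  have hdef : tateS 3 q = ∑' n : ℕ, ((σ 3 (n + 1) : ℕ) : ℚ_[3]) * q ^ (n + 1) := by rw [tateS]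
  rw [hdef, ← hsplit, hone, add_sub_cancel_left]
  refine IsUltrametricDist.norm_tsum_le_of_forall_le_of_nonneg (by norm_num) fun n ↦ ?_
  rw [norm_mul, norm_pow]
  cases n with
  | zero =>
    have h9 : ((σ 3 (0 + 1 + 1) : ℕ) : ℚ_[3]) = 9 := by
      rw [show 0 + 1 + 1 = 2 by rfl, ArithmeticFunction.sigma_apply, Nat.prime_two.divisors,
        Finset.sum_pair (by norm_num)]
      norm_num
    rw [h9, show (9 : ℚ_[3]) = ((9 : ℤ) : ℚ_[3]) by norm_cast]
    calc ‖((9 : ℤ) : ℚ_[3])‖ * ‖q‖ ^ (0 + 1 + 1) ≤ 1 / 9 * (1 / 3) ^ (0 + 1 + 1) := by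
          gcongr; exact (norm_intCast_le_of_pow_dvd (k := 2) (by norm_num)).trans (by norm_num)
      _ ≤ 1 / 27 := by norm_num
  | succ k =>
    calc ‖((σ 3 (k + 1 + 1 + 1) : ℕ) : ℚ_[3])‖ * ‖q‖ ^ (k + 1 + 1 + 1) ≤ 1 * (1 / 3) ^ (k + 1 + 1 + 1) := by
          gcongr; exact norm_natCast_le_one (p := 3) _
      _ = (1 / 3) ^ k * (1 / 27) := by ring
      _ ≤ 1 * (1 / 27) := by gcongr; exact pow_le_one₀ (by norm_num) (by norm_num)
      _ = 1 / 27 := one_mul _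

/-! ### §2 THE Tate parameter to second order -/

/-- **`q ≡ q₀ + 744q₀² (mod 27)`** for THE Tate parameter: if `‖q‖ < 1`, `j(q) = j` and `1/j = q₀` with `‖q₀‖ ≤ 3⁻¹`, then
`‖q − (q₀ + 744q₀²)‖ ≤ 3⁻³` (`1/j(q) = q − 744q² + O(q³)`, tree `norm_inv_tateJ_sub_add_le`). [cite: SilvermanATAEC1994, Thm. V.3.1(b)] -/
theorem norm_tateParam_sub_secondOrder_le {q j q0 : ℚ_[3]} (hq1 : ‖q‖ < 1) (hj : tateJ q = j) (hjinv : j⁻¹ = q0)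
    (hq0 : ‖q0‖ ≤ 1 / 3) : ‖q - (q0 + 744 * q0 ^ 2)‖ ≤ 1 / 27 := by
  have h2 := norm_inv_tateJ_sub_add_le hq1
  have h1 := norm_inv_tateJ_sub_le hq1
  rw [hj, hjinv] at h2 h1
  have hq3 : ‖q‖ ≤ 1 / 3 := norm_le_third_of_norm_lt_one hq1
  have hqq0 : ‖q - q0‖ ≤ 1 / 9 := by
    rw [← norm_neg, neg_sub]; refine h1.trans ?_
    calc ‖q‖ * ‖q‖ ≤ 1 / 3 * (1 / 3) := by gcongr
      _ = 1 / 9 := by norm_num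
  have h744 : ‖(744 : ℚ_[3])‖ ≤ 1 / 3 := by
    rw [show (744 : ℚ_[3]) = ((744 : ℤ) : ℚ_[3]) by norm_cast]
    exact (norm_intCast_le_of_pow_dvd (k := 1) (by norm_num)).trans (by norm_num)
  rw [show q - (q0 + 744 * q0 ^ 2) = -(q0 - q + 744 * q ^ 2) + 744 * ((q - q0) * (q + q0)) by ring]
  refine (IsUltrametricDist.norm_add_le_max _ _).trans (max_le ?_ ?_)
  · rw [norm_neg]; refine h2.trans ?_
    calc ‖q‖ ^ 3 ≤ (1 / 3) ^ 3 := by gcongr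
      _ = 1 / 27 := by norm_num
  · rw [norm_mul, norm_mul]
    calc ‖(744 : ℚ_[3])‖ * (‖q - q0‖ * ‖q + q0‖) ≤ 1 / 3 * (1 / 9 * (1 / 3)) := by
          gcongr; exact (IsUltrametricDist.norm_add_le_max _ _).trans (max_le hq3 hq0)
      _ ≤ 1 / 27 := by norm_num

/-! ### §3 `C²` modulo `81` -/

/-- **`C² ≡ −c₄J(J − 504Δ)/(c₆(J² + 240ΔJ + 178560Δ²)) (mod 81)`, `J = c₄³`.** For any `W/ℚ` with `c₄, c₆` `3`-adic units
(read in `ℚ₃`), `Δ` an integer with `3 ∣ Δ`, any integer `γ` with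
`81 ∣ c₄·c₄³·(c₄³ − 504Δ) + γ·c₆·((c₄³)² + 240·Δ·c₄³ + 178560·Δ²)`, and any `q ∈ ℚ₃` with `‖q − (q₀ + 744q₀²)‖ ≤ 3⁻³`,
`q₀ = Δ/c₄³` (THE Tate parameter to second order): `‖uniformisationScaleSq W 3 q − γ‖ ≤ 3⁻⁴`.
[cite: SteinWuthrich2013, §4.2] [cite: SilvermanATAEC1994, Thm. V.3.1] -/
theorem norm_uniformisationScaleSq_sub_le_o3 (W : WeierstrassCurve ℚ) {c4 c6 D γ : ℤ}
    (hc4 : (W.baseChange ℚ_[3]).c₄ = c4) (hc6 : (W.baseChange ℚ_[3]).c₆ = c6) (h3c4 : ¬ (3 : ℤ) ∣ c4)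
    (h3c6 : ¬ (3 : ℤ) ∣ c6) (h3D : (3 : ℤ) ∣ D)
    (hγ : (81 : ℤ) ∣ c4 * c4 ^ 3 * (c4 ^ 3 - 504 * D) + γ * c6 * ((c4 ^ 3) ^ 2 + 240 * D * c4 ^ 3 + 178560 * D ^ 2))
    {q : ℚ_[3]} (hq : ‖q - ((D : ℚ_[3]) / (c4 : ℚ_[3]) ^ 3 + 744 * ((D : ℚ_[3]) / (c4 : ℚ_[3]) ^ 3) ^ 2)‖ ≤ 1 / 27) :
    ‖uniformisationScaleSq W 3 q - γ‖ ≤ 1 / 81 := by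
  have hc4n : ‖(c4 : ℚ_[3])‖ = 1 := norm_intCast_eq_one_of_not_dvd h3c4
  have hc6n : ‖(c6 : ℚ_[3])‖ = 1 := norm_intCast_eq_one_of_not_dvd h3c6
  have hJn : ‖(c4 : ℚ_[3]) ^ 3‖ = 1 := by rw [norm_pow, hc4n, one_pow]
  have hc40 : (c4 : ℚ_[3]) ≠ 0 := by intro h; rw [h, norm_zero] at hc4n; exact zero_ne_one hc4n
  have hDn : ‖(D : ℚ_[3])‖ ≤ 1 / 3 := (norm_intCast_le_of_pow_dvd (k := 1) (by simpa using h3D)).trans (by norm_num)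
  set q0 : ℚ_[3] := (D : ℚ_[3]) / (c4 : ℚ_[3]) ^ 3 with hq0
  have hq0n : ‖q0‖ ≤ 1 / 3 := by rw [hq0, norm_div, hJn, div_one]; exact hDn
  set q1 : ℚ_[3] := q0 + 744 * q0 ^ 2 with hq1
  have h744 : ‖(744 : ℚ_[3])‖ ≤ 1 / 3 := by
    rw [show (744 : ℚ_[3]) = ((744 : ℤ) : ℚ_[3]) by norm_cast]
    exact (norm_intCast_le_of_pow_dvd (k := 1) (by norm_num)).trans (by norm_num)
  have hq1q0 : ‖q1 - q0‖ ≤ 1 / 27 := by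
    rw [hq1, add_sub_cancel_left, norm_mul, norm_pow]
    calc ‖(744 : ℚ_[3])‖ * ‖q0‖ ^ 2 ≤ 1 / 3 * (1 / 3) ^ 2 := by gcongr
      _ = 1 / 27 := by norm_num
  have hq1n : ‖q1‖ ≤ 1 / 3 := by
    rw [show q1 = (q1 - q0) + q0 by ring]
    exact (IsUltrametricDist.norm_add_le_max _ _).trans (max_le (hq1q0.trans (by norm_num)) hq0n)
  have hqn : ‖q‖ ≤ 1 / 3 := by
    rw [show q = (q - q1) + q1 by ring]
    exact (IsUltrametricDist.norm_add_le_max _ _).trans (max_le (hq.trans (by norm_num)) hq1n)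
  have hq1' : ‖q‖ < 1 := hqn.trans_lt (by norm_num)
  have hqq0 : ‖q - q0‖ ≤ 1 / 9 := by
    rw [show q - q0 = (q - q1) + (q1 - q0) by ring]
    exact (IsUltrametricDist.norm_add_le_max _ _).trans (max_le (hq.trans (by norm_num)) (hq1q0.trans (by norm_num)))
  have hs3 : ‖tateS 3 q - q1‖ ≤ 1 / 27 := by
    rw [show tateS 3 q - q1 = (tateS 3 q - q) + (q - q1) by ring]
    exact (IsUltrametricDist.norm_add_le_max _ _).trans (max_le (norm_tateS_three_sub_self_le hqn) hq)
  have hs5 : ‖tateS 5 q - q0‖ ≤ 1 / 9 := by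
    rw [show tateS 5 q - q0 = (tateS 5 q - q) + (q - q0) by ring]
    refine (IsUltrametricDist.norm_add_le_max _ _).trans (max_le ((norm_tateS_sub_self_le 5 hq1').trans ?_) hqq0)
    calc ‖q‖ ^ 2 ≤ (1 / 3) ^ 2 := by gcongr
      _ = 1 / 9 := by norm_num
  have hs3n : ‖tateS 3 q‖ ≤ 1 / 3 := (TateCurve.norm_tateS_le hq1'.le).trans hqn
  have h12 : (12 : ℚ_[3]) ≠ 0 := by norm_num
  rw [uniformisationScaleSq, TateCurve.tateCurve_c₄, TateCurve.tateCurve_c₆ h12, hc4, hc6, TateCurve.tateE4_eq,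
    TateCurve.tateE6]
  set s3 := tateS 3 q
  set s5 := tateS 5 q
  have hγn : ‖(γ : ℚ_[3])‖ ≤ 1 := Padic.norm_int_le_one _
  have h240 : ‖(240 : ℚ_[3])‖ ≤ 1 / 3 := by
    rw [show (240 : ℚ_[3]) = ((240 : ℤ) : ℚ_[3]) by norm_cast]
    exact (norm_intCast_le_of_pow_dvd (k := 1) (by norm_num)).trans (by norm_num)
  have h504 : ‖(504 : ℚ_[3])‖ ≤ 1 / 9 := by
    rw [show (504 : ℚ_[3]) = ((504 : ℤ) : ℚ_[3]) by norm_cast]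
    exact (norm_intCast_le_of_pow_dvd (k := 2) (by norm_num)).trans (by norm_num)
  have hD0 : ‖(1 + 240 * s3) * (c6 : ℚ_[3])‖ = 1 := by
    have hsub : ‖(1 + 240 * s3) * (c6 : ℚ_[3]) - c6‖ < ‖(c6 : ℚ_[3])‖ := by
      rw [hc6n, show (1 + 240 * s3) * (c6 : ℚ_[3]) - c6 = 240 * s3 * c6 by ring, norm_mul, norm_mul, hc6n]
      calc ‖(240 : ℚ_[3])‖ * ‖s3‖ * 1 ≤ 1 / 3 * (1 / 3) * 1 := by gcongr
        _ < 1 := by norm_num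
    rw [Padic.norm_eq_of_norm_sub_lt_right hsub, hc6n]
  have hD0' : (1 + 240 * s3) * (c6 : ℚ_[3]) ≠ 0 := by
    intro h; rw [h, norm_zero] at hD0; exact zero_ne_one hD0
  rw [div_sub' hD0', norm_div, hD0, div_one]
  have hnum : -(1 - 504 * s5) * (c4 : ℚ_[3]) - (1 + 240 * s3) * (c6 : ℚ_[3]) * (γ : ℚ_[3]) =
      -((((c4 * c4 ^ 3 * (c4 ^ 3 - 504 * D) + γ * c6 * ((c4 ^ 3) ^ 2 + 240 * D * c4 ^ 3 + 178560 * D ^ 2) : ℤ)) :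
        ℚ_[3]) / ((c4 : ℚ_[3]) ^ 3) ^ 2) + 504 * (c4 : ℚ_[3]) * (s5 - q0) +
        -(240 * (γ : ℚ_[3]) * (c6 : ℚ_[3]) * (s3 - q1)) := by
    rw [hq1, hq0]; push_cast; field_simp; ring
  rw [hnum]
  have hJ2 : ‖((c4 : ℚ_[3]) ^ 3) ^ 2‖ = 1 := by rw [norm_pow, hJn, one_pow]
  have h1 : ‖-((((c4 * c4 ^ 3 * (c4 ^ 3 - 504 * D) + γ * c6 * ((c4 ^ 3) ^ 2 + 240 * D * c4 ^ 3 + 178560 * D ^ 2) :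
      ℤ)) : ℚ_[3]) / ((c4 : ℚ_[3]) ^ 3) ^ 2)‖ ≤ 1 / 81 := by
    rw [norm_neg, norm_div, hJ2, div_one]
    exact (norm_intCast_le_of_pow_dvd (k := 4) (by norm_num; exact hγ)).trans (by norm_num)
  have h2 : ‖504 * (c4 : ℚ_[3]) * (s5 - q0)‖ ≤ 1 / 81 := by
    rw [norm_mul, norm_mul, hc4n]
    calc ‖(504 : ℚ_[3])‖ * 1 * ‖s5 - q0‖ ≤ 1 / 9 * 1 * (1 / 9) := by gcongr
      _ = 1 / 81 := by norm_num
  have h3 : ‖-(240 * (γ : ℚ_[3]) * (c6 : ℚ_[3]) * (s3 - q1))‖ ≤ 1 / 81 := by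
    rw [norm_neg, norm_mul, norm_mul, norm_mul, hc6n]
    calc ‖(240 : ℚ_[3])‖ * ‖(γ : ℚ_[3])‖ * 1 * ‖s3 - q1‖ ≤ 1 / 3 * 1 * 1 * (1 / 27) := by gcongr
      _ = 1 / 81 := by norm_num
  refine (IsUltrametricDist.norm_add_le_max _ _).trans (max_le ?_ h3)
  exact (IsUltrametricDist.norm_add_le_max _ _).trans (max_le h1 h2)

end Summit.BirchSwinnertonDyer.Rank1Residual.X11b.RegMult.KernelCert
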